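import Summits.QuantumFields.YangMills.Theorems.BalabanUVNodesN19AtSpineCarriers
import Summits.QuantumFields.YangMills.Theorems.BalabanUVNodesSpineRates
import Literature.MathematicalPhysics.QuantumFieldTheory.Balaban1983to89.Node00.Record11
import Literature.MathematicalPhysics.QuantumFieldTheory.Balaban1983to89.Node00.N23Dossier

/-!
# YM-DAG node N19 (= NE7 proper) — THE KNIT `Spine.NE7.Core → HybridNE7.matchingModConstants` AT THE SPINE CARRIERS OF A STAGE-11 RECORD:
# `T4MatchingAssembly.HybridNE7` assembled FIELD BY FIELD at the remainder of record `deltaOfRecord`, node U5's exit BY NAME, and N19's DECL target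
# `T4CauchySum.MatchingModConstants vol l₀ δ Z ∧ Summable δ` for the dressed partition functions of every loop string along the Wilson schemes of
# every `Node00.IsRecordOfRecord₁₁C` record — with `summable_deltaOfRecord` DISPLAYED as the content-free field it is

Cell `pub-ymgap`, HUMAN RULING D-0062 (Track A), R134 acceleration seat `pub-ymgap-dag-n19-d` (strategy s2 = BY-NAME KNIT at the ₁₁ record; director-ym
R134 row «knit `Spine.NE7.Core` → `HybridNE7.matchingModConstants` :183 at spine carriers ₁₁ with `summable_deltaOfRecord` displayed honestly»; dag-lead
FAN-OUT v1.1 §N19 s2).  Route `Summits/QuantumFields/YangMills/Theses/BalabanUVNodes.lean` rev 6, cluster item K3 «SpineGivenEndpointR11»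
(stmt-QuantumFields-19676); filed `--supports` that item.  COUNT-NEUTRAL: a knit by name over hypothesis shapes; NOT a discharge claim.

WHAT IS KNIT (tree names; line numbers as of 2026-08-26).
* NODE U5's hybrid datum `T4MatchingAssembly.HybridNE7 l₀ vol T A B Bad W shA shB Wsh δ` (T4MatchingAssembly.lean :146) is ASSEMBLED FIELD BY FIELD at ONE
  family of term-class carriers AT THE REMAINDER OF RECORD `δ := N19AtSpineCarriers.deltaOfRecord l₀ vol T Bad (A − shA) (B − shB)` (p418328):
  `weight := N20` (`T4WeightBudget.RelWeightBound`, NE7b) · `shell := N21` (`T4IndicatorShell.ShellWeightBound`, NE7c) · `lt_one :=` U4′'s budget half ·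
  `summable := N19AtSpineCarriers.summable_deltaOfRecord` · `core := N19AtSpineCarriers.core_deltaOfRecord hedge`, where
  `hedge : ∃ δ, Spine.NE7.Core l₀ vol T Bad (A − shA) (B − shB) δ ∧ Summable δ` is N19's ∃δ-EDGE — the shape every landed N19 knit produces
  (`N19RateEdgeByName.rateEdge_of_linkReading_byName` p429766, `N19LedgerLinkSync.core_summable_of_ledgerAtSync` p414645, `N19CentreSync`, …)
  (`hybridNE7_deltaOfRecord`, §1).
* **HONEST DISPLAY (referee pin of record [DAGREFB-G4-PIN-N19-DELTAOFRECORD-JUNK-VALUE], pub-ymgap INBOX l.10444; plan word l.10472 (b)).**  The field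
  `summable` is filled by `summable_deltaOfRecord`, which is TRUE BY CONSTRUCTION (`h.choose_spec.2` in the `then` branch, `summable_zero` in the `else`
  branch of `deltaOfRecord`'s `if`); it carries NO information about Bałaban's runs and is never progress.  THE WHOLE N19 CONTENT IS THE HYPOTHESIS
  `hedge`.  §1's `hybridNE7_deltaOfRecord_iff` records this AS A KERNEL FACT: `HybridNE7 … (deltaOfRecord …)` is EQUIVALENT to
  `N20 ∧ N21 ∧ lt_one ∧ hedge` — the `summable` field drops out of the equivalence precisely because it is content-free, and nothing else is smuggled.
* NODE U5's EXIT BY NAME `T4MatchingAssembly.HybridNE7.matchingModConstants` (:183): with the E1∕E2 dictionary to a sequence `Z` from an offset `K₀` and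
  positivity of run A's class sums, `Spine.NE7.Target vol l₀ (hybridDelta vol (deltaOfRecord …) (W + Wsh)) (K ↦ Z (K₀ + K))`
  (`target_deltaOfRecord_of_coreEdge`); the whole sequence with the head `K < K₀` FREE (`HybridNE7.matchingModConstants_tail` :520,
  `matchingModConstants_deltaOfRecord_tail`).  At the spine-carrier BUNDLE `S : YMDAG.UVSplit.SpineCarriers` under the interim pin `S.δ = deltaOfRecord …`
  (§1′): the datum and the target AT THE CARRIERS' OWN REMAINDER `S.δ` (`hybridNE7_at_carriers_of_pin`, `target_at_carriers_of_pin`).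
* AT A WILSON SCHEME (§2): `Z := T4GenFunBounds.schemeZ S os`; positivity is DISCHARGED (`T4GenFunBounds.dressedZ_pos`) and the head is free
  (`abs_genFun_schemeZ_le`) for `β_K ≥ 0` and measurable observables bounded by `1` — `T4MatchingAssembly.matchingModConstants_schemeZ` BY NAME on the
  `StringHybridNE7` datum at `deltaOfRecord` (`stringHybridNE7_deltaOfRecord`, `matching_schemeZ_of_coreEdge`); for the Wilson scheme `D.scheme g₀` of a
  finite-`ε` datum the three provisos are `D.scheme_β_eq`, `D.measurable_avgObs hM`, `D.abs_avgObs_le_one` GIVEN `hM : D.AvgMeasurable`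
  (`matching_scheme_of_coreEdge`).
* AT THE STAGE-11 RECORD (§3, the «₁₁» of the row): `D.AvgMeasurable` HOLDS at every `Node00.IsRecordOfRecord₁₁C F N D w` (Node00/Record11.lean :670,
  p444286 ✓ d963dac9ac38) — `Node00.avgMeasurable_of_isDatumOfRecord₀` (N23Dossier :93) ∘ `Node00.isDatumOfRecord₀_of_isRecordOfRecord₁₁C` (:713)
  (`avgMeasurable_of_isRecordOfRecord₁₁C`).  Hence over the record predicate `fun F D w ↦ Node00.IsRecordOfRecord₁₁C F N D w` the CLUSTER STUB TEXTS of
  `BalabanUVNodesClustersCore` (p416552) — `S_N27x` (the expansion of record + E1∕E2), `S_N20`, `S_N21`, U4′'s budget half — together with N19's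
  ∃δ-edge `SRec … S → Inputs … → hedge` give, at EVERY ₁₁ record, under (B) and END, for all small-coupling tuned runs and every loop string GIVEN K4's
  conclusion `Inputs`: `∃ l₀ vol δ′, 0 < l₀ ∧ Summable δ′ ∧ T4CauchySum.MatchingModConstants vol l₀ δ′ (schemeZ (D.scheme g₀) os)` — N19's DECL TARGET
  (NODE-TABLE row n19: `T4CauchySum.MatchingModConstants vol l₀ δ Z ∧ Summable δ` :99) for the string's dressed partition functions
  (`matching_at_record₁₁_of_coreEdge`); with K4's hook `SpineRates Rec₁₁ Inputs` CONSUMED (`ForSmallCouplings.and`):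
  `D.UnderHypotheses END (g₀ ↦ T4ApexVariance.StringwiseMatching (D.scheme g₀))` (:1694) at every ₁₁ record (`stringwiseMatching_at_record₁₁_of_spineRates`).
* BY NAME FROM THE RECORD DECLS (FAN-OUT v1.1 §N19 s2): with `Inputs := RateInputs RRec` (module 2 `BalabanUVNodesSpineRates` p418381: `RatesAt D R` =
  N14 · N15 · N16 · N17 · N18 · N22 at the rate carriers) the ∃δ-edge is taken in the OUTPUT SHAPE of `N19RateEdgeByName.rateEdge_of_linkReading_byName`
  ∕ `N19RateEdge.rateEdge_of_linkReading` — `SRec … S → RRec … R → RatesAt D R → ∃ δ, Core (S-cores) δ ∧ Summable δ`, VERBATIM the `hedge` binder of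
  `N19RateEdge.s_N19_rateInputs_of_rateEdge` (compose with either producer; their 113-component link reading is not restated, 400-line rule) — and K4 is
  `SpineRates_of` on module 2's seven stubs `S_R00x Rec₁₁ RRec`, `S_N14 … S_N22 RRec` (ALL SIX in-edges by name, N15 included):
  `stringwiseMatching_at_record₁₁_of_rateStubs`.  The K5 cluster statement itself at ₁₁ (`SpineMatching Rec₁₁ Inputs`, B5 `Spine Rec₁₁`) is ONE
  application of n27-a's generic `BalabanUVNodesN27AtRecord.spineMatching_of_coreEdge` ∕ `spine_of_coreEdge` (p425455 lineage) resp. of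
  `YMDAG.UVSplit.SpineMatching_of` with `S_N19` from `N19AtSpineCarriers.s_N19_of_coreEdge` and `S_U4`'s δ-half from `summable_delta_of_pin` — NOT
  restated here (N27's row); this file stops at N19's own exit, node U5's target.

HONEST FRAMING.  Kernel bookkeeping over hypothesis SHAPES: every theorem composes tree theorems BY NAME; 0 `def`, 0 `sorry`, standard axioms.  NE7 is NOT
PRINTED ([Balaban1987RG1]–[Balaban1989LargeFieldII] bound ONE run; printed template [King1986] (3.10)–(3.13) pp. 656–657, context only) and NOT PROVED: the
∃δ-edge `hedge`, the sibling stubs N20 ∕ N21 ∕ N27x ∕ U4′-budget, K4's hook and the carrier predicates `SRec` ∕ `RRec` are HYPOTHESES ∕ PARAMETERS (no spine-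
or rate-carrier predicate of record exists in the tree — FAN-OUT «RATE-RECORD HOME at the record: NOT in tree»); nothing of Bałaban's is asserted or
instantiated; N19 is NOT discharged; Track A count unmoved (5∕27).  One finite four-torus at fixed ε, rung (B)+1 — NOT infinite volume, NOT OS on ℝ⁴,
NOT a mass gap, NOT Clay.
-/

set_option autoImplicit false

noncomputable section

open Finset MeasureTheory
open scoped BigOperators

namespace Summit.QuantumFields.YangMills.BalabanUVNodes.N19TargetAtRecord11

open Literature.MathematicalPhysics.QuantumFieldTheory.Balaban1983to89
open Literature.MathematicalPhysics.QuantumFieldTheory.Balaban1983to89.T4Continuum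
open T4WeightBudget (RelWeightBound)
open T4IndicatorShell (ShellWeightBound)
open T4MatchingAssembly (HybridNE7 StringHybridNE7 glueDelta matchingModConstants_schemeZ)
open T4HybridMatching (hybridDelta)
open T4CauchySum (MatchingModConstants genFun)
open T4ContinuumYM4Torus (ForSmallCouplings)
open T4ApexVariance (StringwiseMatching)
open Summit.QuantumFields.BalabanUV.T4Continuum.Spine
open Summit.QuantumFields.YangMills.BalabanUVNodes.N19AtSpineCarriers (deltaOfRecord summable_deltaOfRecord core_deltaOfRecord)
open YMDAG.UVSplit (Datum RecordPred SpineCarriers SpineRecordPred InputsPred RateCarriers RateRecordPred RatesAt RateInputs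
  S_N27x S_N20 S_N21 SpineRates S_R00x S_N14 S_N15 S_N16 S_N17 S_N18 S_N22 SpineRates_of)

/-! ## §1 At one family of term-class carriers: `HybridNE7` AT THE REMAINDER OF RECORD, field by field, and node U5's exit by name -/

section Carriers

variable {ι : Type*} [DecidableEq ι] {l₀ vol : ℝ} {T : ℕ → Finset ι} {A B shA shB : ℕ → ℝ → ι → ℝ} {Bad : ℕ → ℝ → Finset ι}
  {W Wsh : ℕ → ℝ}

/-- **`HybridNE7` AT THE REMAINDER OF RECORD, FIELD BY FIELD** [bookkeeping].  `weight := N20`, `shell := N21`, `lt_one :=` U4′'s budget half,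
`summable := summable_deltaOfRecord` (CONTENT-FREE BY CONSTRUCTION — displayed, never progress), `core := core_deltaOfRecord hedge` with N19's ∃δ-edge
`hedge` THE WHOLE N19 CONTENT. [folklore] -/
theorem hybridNE7_deltaOfRecord (h20 : RelWeightBound l₀ T A B Bad W) (h21 : ShellWeightBound l₀ T A B shA shB Wsh)
    (hlt : ∀ K, W K + Wsh K < 1)
    (hedge : ∃ δ : ℕ → ℝ, NE7.Core l₀ vol T Bad (fun K t τ => A K t τ - shA K t τ) (fun K t τ => B K t τ - shB K t τ) δ ∧ Summable δ) :
    HybridNE7 l₀ vol T A B Bad W shA shB Wsh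
      (deltaOfRecord l₀ vol T Bad (fun K t τ => A K t τ - shA K t τ) (fun K t τ => B K t τ - shB K t τ)) where
  weight := h20
  shell := h21
  lt_one := hlt
  summable := summable_deltaOfRecord
  core := core_deltaOfRecord hedge

/-- **FAITHFULNESS — THE HONEST DISPLAY AS A KERNEL FACT** [bookkeeping].  `HybridNE7` at the remainder of record IS `N20 ∧ N21 ∧ lt_one ∧ ∃δ-edge`: the
`summable` field does not occur on the right BECAUSE `summable_deltaOfRecord` is true by construction; the `core` field at `deltaOfRecord` is itself a
witness of the ∃δ-edge.  Nothing beyond the four named inputs is used or produced. [folklore] -/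
theorem hybridNE7_deltaOfRecord_iff :
    HybridNE7 l₀ vol T A B Bad W shA shB Wsh
        (deltaOfRecord l₀ vol T Bad (fun K t τ => A K t τ - shA K t τ) (fun K t τ => B K t τ - shB K t τ)) ↔
      RelWeightBound l₀ T A B Bad W ∧ ShellWeightBound l₀ T A B shA shB Wsh ∧ (∀ K, W K + Wsh K < 1) ∧
        ∃ δ : ℕ → ℝ, NE7.Core l₀ vol T Bad (fun K t τ => A K t τ - shA K t τ) (fun K t τ => B K t τ - shB K t τ) δ ∧ Summable δ :=
  ⟨fun h => ⟨h.weight, h.shell, h.lt_one, _, NE7.core_of_hybridNE7 h, h.summable⟩,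
    fun h => hybridNE7_deltaOfRecord h.1 h.2.1 h.2.2.1 h.2.2.2⟩

/-- **NODE U5's EXIT BY NAME AT THE REMAINDER OF RECORD** [bookkeeping]: N20 · N21 · `lt_one` · N19's ∃δ-edge, the E1∕E2 dictionary to a sequence `Z`
from the offset `K₀` on `|t| ≤ l₀` and positivity of run A's class sums give NODE U5's TARGET `Spine.NE7.Target` = `MatchingModConstants ∧ Summable`
for the shifted sequence with the remainder `hybridDelta vol (deltaOfRecord …) (W + Wsh)` — `T4MatchingAssembly.HybridNE7.matchingModConstants` (:183).
[folklore] -/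
theorem target_deltaOfRecord_of_coreEdge {Z : ℕ → ℝ → ℝ} {K₀ : ℕ} (h20 : RelWeightBound l₀ T A B Bad W)
    (h21 : ShellWeightBound l₀ T A B shA shB Wsh) (hlt : ∀ K, W K + Wsh K < 1)
    (hedge : ∃ δ : ℕ → ℝ, NE7.Core l₀ vol T Bad (fun K t τ => A K t τ - shA K t τ) (fun K t τ => B K t τ - shB K t τ) δ ∧ Summable δ)
    (hvol : 0 < vol) (hl₀ : 0 ≤ l₀)
    (hZA : ∀ (K : ℕ) (t : ℝ), |t| ≤ l₀ → Z (K₀ + K) t = ∑ τ ∈ T K, A K t τ)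
    (hZB : ∀ (K : ℕ) (t : ℝ), |t| ≤ l₀ → Z (K₀ + K + 1) t = ∑ τ ∈ T K, B K t τ)
    (hpos : ∀ (K : ℕ) (t : ℝ), |t| ≤ l₀ → 0 < ∑ τ ∈ T K, A K t τ) :
    NE7.Target vol l₀
      (hybridDelta vol (deltaOfRecord l₀ vol T Bad (fun K t τ => A K t τ - shA K t τ) (fun K t τ => B K t τ - shB K t τ))
        fun K => W K + Wsh K)
      fun K => Z (K₀ + K) :=
  (hybridNE7_deltaOfRecord h20 h21 hlt hedge).matchingModConstants (Z := fun K => Z (K₀ + K)) hvol hl₀ hZA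
    (fun K t ht => by simpa only [Nat.add_assoc] using hZB K t ht) hpos

/-- **… AND FOR THE WHOLE SEQUENCE, THE HEAD FREE** [bookkeeping]: with any bound `|genFun Z K t| ≤ G` on `|t| ≤ l₀` the head `K < K₀` is glued in
(`T4MatchingAssembly.HybridNE7.matchingModConstants_tail` :520): `Spine.NE7.Target vol l₀ (glueDelta K₀ (2G∕vol) (hybridDelta vol (deltaOfRecord …) (W + Wsh))) Z`.
[folklore] -/
theorem matchingModConstants_deltaOfRecord_tail {Z : ℕ → ℝ → ℝ} {K₀ : ℕ} {G : ℝ} (h20 : RelWeightBound l₀ T A B Bad W)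
    (h21 : ShellWeightBound l₀ T A B shA shB Wsh) (hlt : ∀ K, W K + Wsh K < 1)
    (hedge : ∃ δ : ℕ → ℝ, NE7.Core l₀ vol T Bad (fun K t τ => A K t τ - shA K t τ) (fun K t τ => B K t τ - shB K t τ) δ ∧ Summable δ)
    (hvol : 0 < vol) (hl₀ : 0 ≤ l₀)
    (hZA : ∀ (K : ℕ) (t : ℝ), |t| ≤ l₀ → Z (K₀ + K) t = ∑ τ ∈ T K, A K t τ)
    (hZB : ∀ (K : ℕ) (t : ℝ), |t| ≤ l₀ → Z (K₀ + K + 1) t = ∑ τ ∈ T K, B K t τ)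
    (hpos : ∀ (K : ℕ) (t : ℝ), |t| ≤ l₀ → 0 < ∑ τ ∈ T K, A K t τ)
    (hG : ∀ (K : ℕ) (t : ℝ), |t| ≤ l₀ → |genFun Z K t| ≤ G) :
    NE7.Target vol l₀
      (glueDelta K₀ (2 * G / vol)
        (hybridDelta vol (deltaOfRecord l₀ vol T Bad (fun K t τ => A K t τ - shA K t τ) (fun K t τ => B K t τ - shB K t τ))
          fun K => W K + Wsh K))
      Z :=
  (hybridNE7_deltaOfRecord h20 h21 hlt hedge).matchingModConstants_tail hvol hl₀ hZA hZB hpos hG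

end Carriers

/-! ## §1′ At the spine-carrier BUNDLE under the interim pin `S.δ = deltaOfRecord …`: the datum at the carriers' own remainder -/

section Bundle

/-- **AT THE BUNDLE, UNDER THE PIN** [bookkeeping]: if the carrier bundle `S : SpineCarriers` carries the remainder of record as its own field `S.δ` (the interim
pin of `N19AtSpineCarriers`, under which `S_U4`'s δ-half is content-free — `summable_delta_of_pin`), then N20 · N21 · `lt_one` · N19's ∃δ-edge give the hybrid
datum AT THE CARRIERS' OWN REMAINDER, `HybridNE7 S.l₀ S.vol S.T S.A S.B S.Bad S.W S.shA S.shB S.Wsh S.δ` — the five K5 conjuncts of `YMDAG.UVSplit.SpineDatum`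
at `S` except E1∕E2. [folklore] -/
theorem hybridNE7_at_carriers_of_pin (S : SpineCarriers)
    (hpin : letI := S.dec
      S.δ = deltaOfRecord S.l₀ S.vol S.T S.Bad (fun K t τ => S.A K t τ - S.shA K t τ) (fun K t τ => S.B K t τ - S.shB K t τ))
    (h20 : RelWeightBound S.l₀ S.T S.A S.B S.Bad S.W) (h21 : ShellWeightBound S.l₀ S.T S.A S.B S.shA S.shB S.Wsh)
    (hlt : ∀ K, S.W K + S.Wsh K < 1)
    (hedge : letI := S.dec
      ∃ δ : ℕ → ℝ, NE7.Core S.l₀ S.vol S.T S.Bad (fun K t τ => S.A K t τ - S.shA K t τ)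
        (fun K t τ => S.B K t τ - S.shB K t τ) δ ∧ Summable δ) :
    letI := S.dec
    HybridNE7 S.l₀ S.vol S.T S.A S.B S.Bad S.W S.shA S.shB S.Wsh S.δ := by
  letI := S.dec
  rw [hpin]
  exact hybridNE7_deltaOfRecord h20 h21 hlt hedge

/-- **NODE U5's TARGET AT THE BUNDLE, UNDER THE PIN** [bookkeeping]: with E1∕E2 to a sequence `Z` from `S.K₀`, positivity, `0 < S.vol`, `0 ≤ S.l₀`:
`Spine.NE7.Target S.vol S.l₀ (hybridDelta S.vol S.δ (S.W + S.Wsh)) (K ↦ Z (S.K₀ + K))` — `HybridNE7.matchingModConstants` on `hybridNE7_at_carriers_of_pin`. [folklore] -/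
theorem target_at_carriers_of_pin (S : SpineCarriers) {Z : ℕ → ℝ → ℝ}
    (hpin : letI := S.dec
      S.δ = deltaOfRecord S.l₀ S.vol S.T S.Bad (fun K t τ => S.A K t τ - S.shA K t τ) (fun K t τ => S.B K t τ - S.shB K t τ))
    (h20 : RelWeightBound S.l₀ S.T S.A S.B S.Bad S.W) (h21 : ShellWeightBound S.l₀ S.T S.A S.B S.shA S.shB S.Wsh)
    (hlt : ∀ K, S.W K + S.Wsh K < 1)
    (hedge : letI := S.dec
      ∃ δ : ℕ → ℝ, NE7.Core S.l₀ S.vol S.T S.Bad (fun K t τ => S.A K t τ - S.shA K t τ)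
        (fun K t τ => S.B K t τ - S.shB K t τ) δ ∧ Summable δ)
    (hvol : 0 < S.vol) (hl₀ : 0 ≤ S.l₀)
    (hZA : ∀ (K : ℕ) (t : ℝ), |t| ≤ S.l₀ → Z (S.K₀ + K) t = ∑ τ ∈ S.T K, S.A K t τ)
    (hZB : ∀ (K : ℕ) (t : ℝ), |t| ≤ S.l₀ → Z (S.K₀ + K + 1) t = ∑ τ ∈ S.T K, S.B K t τ)
    (hpos : ∀ (K : ℕ) (t : ℝ), |t| ≤ S.l₀ → 0 < ∑ τ ∈ S.T K, S.A K t τ) :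
    NE7.Target S.vol S.l₀ (hybridDelta S.vol S.δ fun K => S.W K + S.Wsh K) fun K => Z (S.K₀ + K) := by
  letI := S.dec
  exact (hybridNE7_at_carriers_of_pin S hpin h20 h21 hlt hedge).matchingModConstants (Z := fun K => Z (S.K₀ + K)) hvol hl₀ hZA
    (fun K t ht => by simpa only [Nat.add_assoc] using hZB K t ht) hpos

end Bundle

/-! ## §2 At a Wilson scheme: positivity discharged, head free — node U5's per-string output -/

section Scheme

variable {G : Type*} [GaugeGroup G] [MeasurableSpace G] [RegularGaugeGroup G] [HaarData G] {O : Type*}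
variable {ι : Type} [DecidableEq ι] {l₀ vol : ℝ} {T : ℕ → Finset ι} {A B shA shB : ℕ → ℝ → ι → ℝ} {Bad : ℕ → ℝ → Finset ι}
  {W Wsh : ℕ → ℝ}

omit [RegularGaugeGroup G] in
/-- The per-string hybrid-NE7 datum `T4MatchingAssembly.StringHybridNE7 S os l₀ vol K₀` (:560) AT THE REMAINDER OF RECORD: §1 + the E1∕E2 dictionary to the
scheme's dressed partition functions of the string from `K₀` on. [bookkeeping] [folklore] -/
theorem stringHybridNE7_deltaOfRecord (S : Missing.TorusScheme G O) (os : List O) {K₀ : ℕ} (h20 : RelWeightBound l₀ T A B Bad W)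
    (h21 : ShellWeightBound l₀ T A B shA shB Wsh) (hlt : ∀ K, W K + Wsh K < 1)
    (hedge : ∃ δ : ℕ → ℝ, NE7.Core l₀ vol T Bad (fun K t τ => A K t τ - shA K t τ) (fun K t τ => B K t τ - shB K t τ) δ ∧ Summable δ)
    (hE1 : ∀ (K : ℕ) (t : ℝ), |t| ≤ l₀ → T4GenFunBounds.schemeZ S os (K₀ + K) t = ∑ τ ∈ T K, A K t τ)
    (hE2 : ∀ (K : ℕ) (t : ℝ), |t| ≤ l₀ → T4GenFunBounds.schemeZ S os (K₀ + K + 1) t = ∑ τ ∈ T K, B K t τ) :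
    StringHybridNE7 S os l₀ vol K₀ :=
  ⟨ι, ‹_›, T, A, B, shA, shB, Bad, W, Wsh, _, hybridNE7_deltaOfRecord h20 h21 hlt hedge, hE1, hE2⟩

/-- **NODE U5's PER-STRING OUTPUT AT A WILSON SCHEME** [bookkeeping]: for a scheme with `β_K ≥ 0` and measurable observables bounded by `1`, N20 · N21 · `lt_one`
· N19's ∃δ-edge · E1∕E2 (from `K₀`, with `0 ≤ l₀`, `0 < vol`) give `∃ δ′, Summable δ′ ∧ MatchingModConstants vol l₀ δ′ (schemeZ S os)` — positivity of run
A's class sums DISCHARGED by `T4GenFunBounds.dressedZ_pos`, head free (`T4MatchingAssembly.matchingModConstants_schemeZ` BY NAME).  Output literally the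
per-string hypothesis of `T4Assembly.genFunCauchy_of_matchingModConstants`. [folklore] -/
theorem matching_schemeZ_of_coreEdge (S : Missing.TorusScheme G O) (hβ : ∀ K, 0 ≤ S.β K) (hm : ∀ K o, Measurable (S.obs K o))
    (h1 : ∀ K o U, |S.obs K o U| ≤ 1) (os : List O) {K₀ : ℕ} (hl₀ : 0 ≤ l₀) (hvol : 0 < vol)
    (h20 : RelWeightBound l₀ T A B Bad W) (h21 : ShellWeightBound l₀ T A B shA shB Wsh) (hlt : ∀ K, W K + Wsh K < 1)
    (hedge : ∃ δ : ℕ → ℝ, NE7.Core l₀ vol T Bad (fun K t τ => A K t τ - shA K t τ) (fun K t τ => B K t τ - shB K t τ) δ ∧ Summable δ)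
    (hE1 : ∀ (K : ℕ) (t : ℝ), |t| ≤ l₀ → T4GenFunBounds.schemeZ S os (K₀ + K) t = ∑ τ ∈ T K, A K t τ)
    (hE2 : ∀ (K : ℕ) (t : ℝ), |t| ≤ l₀ → T4GenFunBounds.schemeZ S os (K₀ + K + 1) t = ∑ τ ∈ T K, B K t τ) :
    ∃ δ' : ℕ → ℝ, Summable δ' ∧ MatchingModConstants vol l₀ δ' (T4GenFunBounds.schemeZ S os) :=
  matchingModConstants_schemeZ S hβ hm h1 hl₀ hvol os (stringHybridNE7_deltaOfRecord S os h20 h21 hlt hedge hE1 hE2)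

/-- **… AT THE WILSON SCHEME OF A FINITE-`ε` DATUM** [bookkeeping]: for `D.scheme g₀` the three provisos are `D.scheme_β_eq` (`β_K = (g₀ K)⁻² ≥ 0`),
`D.measurable_avgObs hM` and `D.abs_avgObs_le_one` GIVEN `hM : D.AvgMeasurable`. [folklore] -/
theorem matching_scheme_of_coreEdge {F : T4Family} (D : FiniteEpsData F G) (hM : D.AvgMeasurable) (g₀ : ℕ → ℝ) (os : List (ULoop F))
    {K₀ : ℕ} (hl₀ : 0 ≤ l₀) (hvol : 0 < vol)
    (h20 : RelWeightBound l₀ T A B Bad W) (h21 : ShellWeightBound l₀ T A B shA shB Wsh) (hlt : ∀ K, W K + Wsh K < 1)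
    (hedge : ∃ δ : ℕ → ℝ, NE7.Core l₀ vol T Bad (fun K t τ => A K t τ - shA K t τ) (fun K t τ => B K t τ - shB K t τ) δ ∧ Summable δ)
    (hE1 : ∀ (K : ℕ) (t : ℝ), |t| ≤ l₀ → T4GenFunBounds.schemeZ (D.scheme g₀) os (K₀ + K) t = ∑ τ ∈ T K, A K t τ)
    (hE2 : ∀ (K : ℕ) (t : ℝ), |t| ≤ l₀ → T4GenFunBounds.schemeZ (D.scheme g₀) os (K₀ + K + 1) t = ∑ τ ∈ T K, B K t τ) :
    ∃ δ' : ℕ → ℝ, Summable δ' ∧ MatchingModConstants vol l₀ δ' (T4GenFunBounds.schemeZ (D.scheme g₀) os) :=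
  matching_schemeZ_of_coreEdge (D.scheme g₀) (fun K => (D.scheme_β_eq g₀ K).2) (fun K C => D.measurable_avgObs hM K C)
    (fun K C U => D.abs_avgObs_le_one K C U) os hl₀ hvol h20 h21 hlt hedge hE1 hE2

end Scheme

/-! ## §3 At the Stage-11 record `Node00.IsRecordOfRecord₁₁C`: N19's DECL target along the record's Wilson schemes -/

section Record

variable {N : ℕ} [NeZero N]

/-- **`AvgMeasurable` HOLDS AT EVERY STAGE-11 RECORD** [bookkeeping]: a ₁₁ record's datum is a Stage-0 datum of record
(`Node00.isDatumOfRecord₀_of_isRecordOfRecord₁₁C`), whose averaging maps are the printed ones, measurable (`Node00.avgMeasurable_of_isDatumOfRecord₀`, N23's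
dossier).  This is the one record fact node U5's exit reads (positivity of the dressed partition functions). [folklore] -/
theorem avgMeasurable_of_isRecordOfRecord₁₁C {F : T4Family} {D : Datum F N} {w : DagBinding.WorldP}
    (h : Node00.IsRecordOfRecord₁₁C F N D w) : D.AvgMeasurable :=
  Node00.avgMeasurable_of_isDatumOfRecord₀ (Node00.isDatumOfRecord₀_of_isRecordOfRecord₁₁C h)

/-- **N19's DECL TARGET AT EVERY STAGE-11 RECORD, GUARDED BY K4's CONCLUSION** [bookkeeping].  Over the record predicate
`fun F D w ↦ Node00.IsRecordOfRecord₁₁C F N D w`, for PARAMETERS `SRec` (spine carriers of record) and `Inputs` (K4's hook): the cluster stub texts `S_N27x`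
(the expansion of record with `0 < l₀`, `0 < vol` and E1∕E2), `S_N20` (NE7b), `S_N21` (NE7c), U4′'s budget half, and N19's ∃δ-EDGE «`SRec … S → Inputs … →
∃ δ, Spine.NE7.Core (S-cores) δ ∧ Summable δ`» give, at every ₁₁ record `(D, w)` with (B) and END, for all small-coupling tuned runs `g₀` and every loop
string `os` carrying K4's conclusion: `∃ l₀ vol δ′, 0 < l₀ ∧ Summable δ′ ∧ T4CauchySum.MatchingModConstants vol l₀ δ′ (schemeZ (D.scheme g₀) os)` —
matching modulo `t`-independent constants of the string's dressed partition functions with a summable remainder.  §2 per string at the bundle the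
expansion of record supplies, `AvgMeasurable` from the record; the carriers' own field `S.δ` is NOT read (no pin needed for the target). [folklore] -/
theorem matching_at_record₁₁_of_coreEdge (SRec : SpineRecordPred N) (Inputs : InputsPred N)
    (hx : S_N27x (fun F D w => Node00.IsRecordOfRecord₁₁C F N D w) SRec) (h20 : S_N20 SRec) (h21 : S_N21 SRec)
    (hlt : ∀ (F : T4Family) (D : Datum F N) (g₀ : ℕ → ℝ) (os : List (ULoop F)) (S : SpineCarriers),
      SRec F D g₀ os S → ∀ K, S.W K + S.Wsh K < 1)
    (hedge : ∀ (F : T4Family) (D : Datum F N) (g₀ : ℕ → ℝ) (os : List (ULoop F)) (S : SpineCarriers),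
      SRec F D g₀ os S → Inputs F D g₀ os → letI := S.dec
      ∃ δ : ℕ → ℝ, NE7.Core S.l₀ S.vol S.T S.Bad (fun K t τ => S.A K t τ - S.shA K t τ)
        (fun K t τ => S.B K t τ - S.shB K t τ) δ ∧ Summable δ)
    {F : T4Family} {D : Datum F N} {w : DagBinding.WorldP} (hR : Node00.IsRecordOfRecord₁₁C F N D w)
    (hB : B16.EndStatementBPrinted D.C) (hE : DagBinding.EndpointExistence D.C.toB12) :
    ForSmallCouplings D fun g₀ => ∀ os : List (ULoop F), Inputs F D g₀ os →
      ∃ (l₀ vol : ℝ) (δ' : ℕ → ℝ), 0 < l₀ ∧ Summable δ' ∧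
        MatchingModConstants vol l₀ δ' (T4GenFunBounds.schemeZ (D.scheme g₀) os) := by
  refine (hx F D w hR hB hE).mono fun g₀ hg os hI => ?_
  obtain ⟨S, hS, hl₀, hvol, hZA, hZB⟩ := hg os
  letI := S.dec
  obtain ⟨δ', hδ', hM⟩ := matching_scheme_of_coreEdge D (avgMeasurable_of_isRecordOfRecord₁₁C hR) g₀ os hl₀.le hvol
    (h20 F D g₀ os S hS) (h21 F D g₀ os S hS) (hlt F D g₀ os S hS) (hedge F D g₀ os S hS hI) hZA hZB
  exact ⟨S.l₀, S.vol, δ', hl₀, hδ', hM⟩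

/-- **N19's DECL TARGET STRING-WISE AT EVERY STAGE-11 RECORD, K4 CONSUMED** [bookkeeping]: the hypotheses of `matching_at_record₁₁_of_coreEdge` and K4's hook
`SpineRates Rec₁₁ Inputs` (the in-edges hold for every string under the prefix) give `D.UnderHypotheses END (g₀ ↦ T4ApexVariance.StringwiseMatching (D.scheme g₀))`
at every ₁₁ record — node U5's target BY NAME along the record's Wilson schemes (the two prefixes conjoined at the smaller thresholds, `ForSmallCouplings.and`,
modus ponens per string). [folklore] -/
theorem stringwiseMatching_at_record₁₁_of_spineRates (SRec : SpineRecordPred N) (Inputs : InputsPred N)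
    (hx : S_N27x (fun F D w => Node00.IsRecordOfRecord₁₁C F N D w) SRec) (h20 : S_N20 SRec) (h21 : S_N21 SRec)
    (hlt : ∀ (F : T4Family) (D : Datum F N) (g₀ : ℕ → ℝ) (os : List (ULoop F)) (S : SpineCarriers),
      SRec F D g₀ os S → ∀ K, S.W K + S.Wsh K < 1)
    (hedge : ∀ (F : T4Family) (D : Datum F N) (g₀ : ℕ → ℝ) (os : List (ULoop F)) (S : SpineCarriers),
      SRec F D g₀ os S → Inputs F D g₀ os → letI := S.dec
      ∃ δ : ℕ → ℝ, NE7.Core S.l₀ S.vol S.T S.Bad (fun K t τ => S.A K t τ - S.shA K t τ)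
        (fun K t τ => S.B K t τ - S.shB K t τ) δ ∧ Summable δ)
    (h4 : SpineRates (fun F D w => Node00.IsRecordOfRecord₁₁C F N D w) Inputs)
    {F : T4Family} {D : Datum F N} {w : DagBinding.WorldP} (hR : Node00.IsRecordOfRecord₁₁C F N D w) :
    D.UnderHypotheses (DagBinding.EndpointExistence D.C.toB12) fun g₀ => StringwiseMatching (D.scheme g₀) := by
  intro hB hE
  exact ((h4 F D w hR hB hE).and (matching_at_record₁₁_of_coreEdge SRec Inputs hx h20 h21 hlt hedge hR hB hE)).mono
    fun g₀ hg os => hg.2 os (hg.1 os)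

/-- **BY NAME FROM THE RECORD DECLS: K4's hook `RateInputs RRec`, the ∃δ-edge in the RATE-EDGE's output shape** [bookkeeping].  With module 2's rate-carrier
predicate `RRec` (PARAMETER) and `Inputs := RateInputs RRec` (`RatesAt D R` = N14 · N15 · N16 · N17 · N18 · N22 at the rate carriers `R`), N19's edge is taken
as «`SRec … S → RRec … R → RatesAt D R → ∃ δ, Core (S-cores) δ ∧ Summable δ`» — VERBATIM the conclusion of `N19RateEdgeByName.rateEdge_of_linkReading_byName`
(p429766; in-edges consumed from `RatesAt` by name) and the `hedge` binder of `N19RateEdge.s_N19_rateInputs_of_rateEdge` — whence the guarded target of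
`matching_at_record₁₁_of_coreEdge` at `RateInputs RRec`. [folklore] -/
theorem matching_at_record₁₁_of_rateEdge (SRec : SpineRecordPred N) (RRec : RateRecordPred N)
    (hx : S_N27x (fun F D w => Node00.IsRecordOfRecord₁₁C F N D w) SRec) (h20 : S_N20 SRec) (h21 : S_N21 SRec)
    (hlt : ∀ (F : T4Family) (D : Datum F N) (g₀ : ℕ → ℝ) (os : List (ULoop F)) (S : SpineCarriers),
      SRec F D g₀ os S → ∀ K, S.W K + S.Wsh K < 1)
    (hedgeR : ∀ (F : T4Family) (D : Datum F N) (g₀ : ℕ → ℝ) (os : List (ULoop F)) (S : SpineCarriers) (R : RateCarriers N),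
      SRec F D g₀ os S → RRec F D g₀ os R → RatesAt D R → letI := S.dec
      ∃ δ : ℕ → ℝ, NE7.Core S.l₀ S.vol S.T S.Bad (fun K t τ => S.A K t τ - S.shA K t τ)
        (fun K t τ => S.B K t τ - S.shB K t τ) δ ∧ Summable δ)
    {F : T4Family} {D : Datum F N} {w : DagBinding.WorldP} (hR : Node00.IsRecordOfRecord₁₁C F N D w)
    (hB : B16.EndStatementBPrinted D.C) (hE : DagBinding.EndpointExistence D.C.toB12) :
    ForSmallCouplings D fun g₀ => ∀ os : List (ULoop F), RateInputs RRec F D g₀ os →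
      ∃ (l₀ vol : ℝ) (δ' : ℕ → ℝ), 0 < l₀ ∧ Summable δ' ∧
        MatchingModConstants vol l₀ δ' (T4GenFunBounds.schemeZ (D.scheme g₀) os) :=
  matching_at_record₁₁_of_coreEdge SRec (RateInputs RRec) hx h20 h21 hlt (fun F D g₀ os S hS hI => by
    obtain ⟨R, hRR, hrates⟩ := hI
    exact hedgeR F D g₀ os S R hS hRR hrates) hR hB hE

/-- **THE TOP OF THE KNIT — N19's DECL TARGET AT EVERY STAGE-11 RECORD FROM THE STUB TEXTS OF MODULES 1 AND 2 AND N19's RATE EDGE** [bookkeeping].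
Module 2 (`BalabanUVNodesSpineRates`): `S_R00x Rec₁₁ RRec` (the rate carriers of record exist under the pins) and the SIX in-edges BY NAME `S_N14` (NE1′) ·
`S_N15` (NE2) · `S_N16` (NE3) · `S_N17` (NE4) · `S_N18` (NE5) · `S_N22` (NE9 ∧ fading memory) at `RRec` ⇒ K4 `SpineRates Rec₁₁ (RateInputs RRec)`
(`SpineRates_of`); module 1 (`BalabanUVNodesClustersCore`): `S_N27x Rec₁₁ SRec` · `S_N20 SRec` · `S_N21 SRec` · U4′'s budget half; N19: the rate edge
«`SRec ∧ RRec ∧ RatesAt ⇒ ∃ δ, Core ∧ Summable δ`».  CONCLUSION: at every `Node00.IsRecordOfRecord₁₁C F N D w`,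
`D.UnderHypotheses END (g₀ ↦ T4ApexVariance.StringwiseMatching (D.scheme g₀))` — for all small-coupling tuned runs, EVERY loop string's dressed partition
functions match modulo constants with a summable remainder (`T4CauchySum.MatchingModConstants vol l₀ δ Z ∧ Summable δ`, N19's DECL target).  All binders are
hypotheses ∕ parameters; nothing of Bałaban's is asserted. [folklore] -/
theorem stringwiseMatching_at_record₁₁_of_rateStubs (SRec : SpineRecordPred N) (RRec : RateRecordPred N)
    (hxR : S_R00x (fun F D w => Node00.IsRecordOfRecord₁₁C F N D w) RRec) (h14 : S_N14 RRec) (h15 : S_N15 RRec) (h16 : S_N16 RRec)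
    (h17 : S_N17 RRec) (h18 : S_N18 RRec) (h22 : S_N22 RRec)
    (hx : S_N27x (fun F D w => Node00.IsRecordOfRecord₁₁C F N D w) SRec) (h20 : S_N20 SRec) (h21 : S_N21 SRec)
    (hlt : ∀ (F : T4Family) (D : Datum F N) (g₀ : ℕ → ℝ) (os : List (ULoop F)) (S : SpineCarriers),
      SRec F D g₀ os S → ∀ K, S.W K + S.Wsh K < 1)
    (hedgeR : ∀ (F : T4Family) (D : Datum F N) (g₀ : ℕ → ℝ) (os : List (ULoop F)) (S : SpineCarriers) (R : RateCarriers N),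
      SRec F D g₀ os S → RRec F D g₀ os R → RatesAt D R → letI := S.dec
      ∃ δ : ℕ → ℝ, NE7.Core S.l₀ S.vol S.T S.Bad (fun K t τ => S.A K t τ - S.shA K t τ)
        (fun K t τ => S.B K t τ - S.shB K t τ) δ ∧ Summable δ)
    {F : T4Family} {D : Datum F N} {w : DagBinding.WorldP} (hR : Node00.IsRecordOfRecord₁₁C F N D w) :
    D.UnderHypotheses (DagBinding.EndpointExistence D.C.toB12) fun g₀ => StringwiseMatching (D.scheme g₀) :=
  stringwiseMatching_at_record₁₁_of_spineRates SRec (RateInputs RRec) hx h20 h21 hlt (fun F D g₀ os S hS hI => by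
      obtain ⟨R, hRR, hrates⟩ := hI
      exact hedgeR F D g₀ os S R hS hRR hrates)
    (SpineRates_of (fun F D w => Node00.IsRecordOfRecord₁₁C F N D w) RRec hxR h14 h15 h16 h17 h18 h22) hR

end Record

/-! ## §4 Sanity: §1 fires on the trivial carriers (the clauses are jointly satisfiable; no content) -/

/-- SANITY [folklore]: one class, equal unit weights in both runs, no bad class, no shells, zero weight slots, the constant sequence `Z = 1` from `K₀ = 0`:
the ∃δ-edge holds with `δ = 0`, and §1 returns node U5's target at the remainder of record.  Shows only that the hypothesis list of
`target_deltaOfRecord_of_coreEdge` is inhabited. [folklore] -/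
example : NE7.Target (1 : ℝ) 1
    (hybridDelta 1 (deltaOfRecord (1 : ℝ) 1 (fun _ => ({()} : Finset Unit)) (fun _ _ => ∅)
      (fun K t τ => (fun _ _ _ => (1 : ℝ)) K t τ - (fun _ _ _ => (0 : ℝ)) K t τ)
      (fun K t τ => (fun _ _ _ => (1 : ℝ)) K t τ - (fun _ _ _ => (0 : ℝ)) K t τ))
      fun K => (fun _ => (0 : ℝ)) K + (fun _ => (0 : ℝ)) K)
    fun K => (fun _ _ => (1 : ℝ)) (0 + K) := by
  have hH := T4MatchingAssembly.hybridNE7_trivial (1 : ℝ) 1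
  refine target_deltaOfRecord_of_coreEdge (K₀ := 0) (Z := fun _ _ => (1 : ℝ)) hH.weight hH.shell hH.lt_one
    ⟨fun _ => 0, NE7.core_of_hybridNE7 hH, summable_zero⟩ one_pos zero_le_one (fun K t _ => by simp) (fun K t _ => by simp)
    fun K t _ => by simp

end Summit.QuantumFields.YangMills.BalabanUVNodes.N19TargetAtRecord11

end
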